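import Summits.ABC.ABC.Theorems.TwistAmplificationSharpModerateLawCuspCoordinates
import Literature.NumberTheory.DiophantineGeometry.ConductorExponentLeEightProofs

/-!
# Crux `TwistAmplification.SharpModerateLaw` (stmt-ABC-1975): the conductor is at most `2⁸·3⁵` times its proxy

Lead `prover-line-stmt-ABC-1975-c6-0` (line `unit-plane-conic-two-torsion`, skeleton v5.1), support for the CONVERSE
transfer `SharpModerateLaw → CoreLaw` (file `…TwistMinimalConverse.lean`): for an integral model minimal at every place,
the conductor divides `2⁸ · 3⁵ · N5cusp (c₄, c₆)` — with `n5cusp_dvd_conductorNorm` (`…CuspCoordinates.lean`) the proxy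
`N5cusp` is the conductor up to the factor at `6`. Ingredients (all in the tree): `f_p = 0` for `p ∤ Δ`, `f_p = 1` for
`p ∣ Δ`, `p ∤ c₄`, `f_p ≤ 2` for `p ≥ 5`, `f_2 ≤ 8`, `f_3 ≤ 5` (B–G 12.5.9, Silverman ATAEC IV.10.4, Brumer–Kramer 6.2).
-/

noncomputable section

-- the mandated summit namespace `Summit.ABC.ABC` (summit = problem) trips the duplicate-namespace linter
set_option linter.dupNamespace false

namespace Summit.ABC.ABC.Theorems.SharpModerateLaw

open WeierstrassCurve IsDedekindDomain Rat.HeightOneSpectrum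

/-- A prime other than `2` and `3` is at least `5`. -/
theorem five_le_of_prime_ne {p : ℕ} (hp : p.Prime) (h2 : p ≠ 2) (h3 : p ≠ 3) : 5 ≤ p := by
  have h4 : p ≠ 4 := fun h => by rw [h] at hp; exact absurd hp (by decide)
  have := hp.two_le
  omega

/-- For `p ≥ 5` dividing `Δ`, the local factor of the proxy: `p ^ (2 if p ∣ c₄ else 1) ∣ N5cusp (c₄, c₆)` for an
integral model `W` (so that `(c₄³ − c₆²)/1728 = Δ`). -/
theorem pow_dvd_n5cusp_of_dvd_Δ (W : WeierstrassCurve ℤ) (hΔ0 : W.Δ ≠ 0) {p : ℕ} (hp : p.Prime) (h5 : 5 ≤ p)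
    (hpΔ : (p : ℤ) ∣ W.Δ) :
    (if ((p : ℕ) : ℤ) ∣ W.c₄ then p ^ 2 else p) ∣ N5cusp (W.c₄, W.c₆) := by
  unfold N5cusp
  simp only [c₄_cube_sub_c₆_sq_ediv]
  apply Finset.dvd_prod_of_mem
  refine Finset.mem_filter.mpr ⟨?_, h5⟩
  exact Nat.mem_primeFactors.mpr ⟨hp, Int.natAbs_dvd_natAbs.mpr hpΔ |>.trans (by simp),
    Int.natAbs_ne_zero.mpr hΔ0⟩

/-- **The conductor divides `2⁸ · 3⁵ · N5cusp (c₄, c₆)`** for an integral model minimal at every place. -/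
theorem conductorNorm_dvd_mul_n5cusp : ∀ {W : WeierstrassCurve ℤ} [(W.baseChange ℚ).IsElliptic], (∀ v : IsDedekindDomain.HeightOneSpectrum ℤ, (W.baseChange ℚ).IsMinimalAt v) → (W.baseChange ℚ).conductorNorm ℤ ∣ 2 ^ 8 * 3 ^ 5 * N5cusp (W.c₄, W.c₆) := by
  intro W _ hmin
  have hΔ0 : W.Δ ≠ 0 := Δ_ne_zero_of_isElliptic_baseChange_int W
  have hN5 : N5cusp (W.c₄, W.c₆) ≠ 0 := by
    unfold N5cusp
    exact Finset.prod_ne_zero_iff.mpr fun p hp => by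
      have hp' := (Nat.prime_of_mem_primeFactors (Finset.mem_filter.mp hp).1).pos
      split_ifs <;> positivity
  have hB : 2 ^ 8 * 3 ^ 5 * N5cusp (W.c₄, W.c₆) ≠ 0 := mul_ne_zero (by norm_num) hN5
  refine conductorNorm_dvd_of_forall_conductorExponent_le _ hB fun q => ?_
  obtain ⟨p, hp⟩ := q
  rw [← hp.pow_dvd_iff_le_factorization hB]
  set v : HeightOneSpectrum ℤ := (primesEquiv (R := ℤ)).symm ⟨p, hp⟩ with hv
  have hgen : natGenerator v = p :=
    Literature.NumberTheory.EllipticCurves.Rat.natGenerator_primesEquiv_symm ⟨p, hp⟩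
  by_cases h2 : p = 2
  · subst h2
    have h8 : (W.baseChange ℚ).conductorExponent v ≤ 8 := conductorExponent_le_eight_holds (W.baseChange ℚ) v
    exact (pow_dvd_pow 2 h8).trans (Dvd.intro (3 ^ 5 * N5cusp (W.c₄, W.c₆)) (by ring))
  by_cases h3 : p = 3
  · subst h3
    have h5 : (W.baseChange ℚ).conductorExponent v ≤ 5 :=
      conductorExponent_le_five_of_natGenerator_eq_three_holds (W.baseChange ℚ) v hgen
    exact (pow_dvd_pow 3 h5).trans (Dvd.intro (2 ^ 8 * N5cusp (W.c₄, W.c₆)) (by ring))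
  have h5p : 5 ≤ p := five_le_of_prime_ne hp h2 h3
  by_cases hpΔ : (p : ℤ) ∣ W.Δ
  · have hloc := pow_dvd_n5cusp_of_dvd_Δ W hΔ0 hp h5p hpΔ
    refine dvd_trans ?_ (hloc.trans (dvd_mul_left _ _))
    by_cases hc : ((p : ℕ) : ℤ) ∣ W.c₄
    · rw [if_pos hc]
      have h2' : (W.baseChange ℚ).conductorExponent v ≤ 2 :=
        conductorExponent_le_two_of_five_le_natGenerator_holds (W.baseChange ℚ) v (by rw [hgen]; exact h5p)
      exact pow_dvd_pow p h2'
    · rw [if_neg hc]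
      have h1 : (W.baseChange ℚ).conductorExponent v = 1 :=
        conductorExponent_eq_one_of_dvd_Δ_of_not_dvd_c₄ (hmin v) (by rw [hgen]; exact hpΔ) (by rw [hgen]; exact hc)
      rw [h1, pow_one]
  · have h0 : (W.baseChange ℚ).conductorExponent v = 0 :=
      conductorExponent_eq_zero_of_not_dvd_Δ (hmin v) (by rw [hgen]; exact hpΔ)
    rw [h0, pow_zero]
    exact one_dvd _

/-- **`N ≤ 62208 · N5cusp (c₄, c₆)`** (real form) for an integral model minimal at every place. -/
theorem conductorNorm_le_mul_n5cusp {W : WeierstrassCurve ℤ} [(W.baseChange ℚ).IsElliptic]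
    (hmin : ∀ v : HeightOneSpectrum ℤ, (W.baseChange ℚ).IsMinimalAt v) :
    (((W.baseChange ℚ).conductorNorm ℤ : ℕ) : ℝ) ≤ 62208 * (N5cusp (W.c₄, W.c₆) : ℝ) := by
  have hN5 : N5cusp (W.c₄, W.c₆) ≠ 0 := by
    unfold N5cusp
    exact Finset.prod_ne_zero_iff.mpr fun p hp => by
      have hp' := (Nat.prime_of_mem_primeFactors (Finset.mem_filter.mp hp).1).pos
      split_ifs <;> positivity
  have h := Nat.le_of_dvd (Nat.pos_of_ne_zero (mul_ne_zero (by norm_num) hN5)) (conductorNorm_dvd_mul_n5cusp hmin)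
  have h' : (((W.baseChange ℚ).conductorNorm ℤ : ℕ) : ℝ) ≤ ((2 ^ 8 * 3 ^ 5 * N5cusp (W.c₄, W.c₆) : ℕ) : ℝ) := by
    exact_mod_cast h
  refine h'.trans (le_of_eq ?_)
  push_cast
  ring

end Summit.ABC.ABC.Theorems.SharpModerateLaw

end
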